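import Summits.Ventures.YMGap.RobustBall.DobrushinSupersolution
import Summits.Ventures.YMGap.RobustBall.ZdAxisProfile
import Summits.Ventures.YMGap.SlabAreaLawDimensions
import Summits.Ventures.YMGap.Thresholds.StateLipschitzRows
import Literature.MathematicalPhysics.QuantumFieldTheory.Balaban1983to89.StrongCouplingKernelWindow
import HarnessLib

/-!
# Robust ball (Y2) — exponential clustering of `SU(N)` lattice Yang–Mills on `ℤ^d` ALONG A LATTICE AXIS at the single-entry
# rate (axis supersolution), and the `SU(2)`, `d = 4` cells

HONEST FRAMING: venture file of the cell `pub-ymgap` (QuantumFields programme), track ROBUST-BALL, seat rb-p2 (g10).  Strong-coupling LATTICE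
statements about DLR states of the Wilson specification on `ℤ^d`; the rates are Dobrushin-door floors on the decay of truncated correlations
(upper bounds on the correlation length), not computations of the mass gap; nothing continuum / spectral / Clay.

WHAT IS NEW.  The tree's `ℤ^d` clustering (`MassGapOfDoor.perturbed_covariance_decay_of_isKRContraction`, Shen–Zhu–Zhu shape) runs the
covariance estimate with the `ℓ∞` row-sum profile: rate `−log ρ`, `ρ = 6(d−1)κ`, `κ = K|β|` the one-link coefficient ('t Hooft `β`).  For
observables separated ALONG A COORDINATE AXIS `i` (the `f`-support below the `g`-support by `n` lattice units in direction `i`, i.e. by `2n`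
in the doubled midpoint coordinate `H_i(x, μ) = 2x_i + [μ = i]`) the half-line vector `v = φ^{(a − H_i)_+}` is a supersolution of Dobrushin's
matrix `κ · linkInfluence` as soon as  `κ · 2(d−1)(φ⁻¹ + 1 + φ) ≤ 1` (links parallel to `i`) and `κ(φ⁻² + 2φ⁻¹ + 2φ + φ² + 6(d−2)) ≤ 1`
(transverse links) — the exact offset multisets of `ZdAxisProfile` — whence (`ym_abs_cov_le_axis`) for EVERY DLR state
`|cov_μ(f, g)| ≤ 8N (Σδ_g)(Σδ_f) φ^{2n}`: decay `θ = φ²` per lattice unit with `θ = κ(1 + O(√κ))`, against the row-sum `ρ = 6(d−1)κ`.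
`SU(2)`, `d = 4` (`κ = β_W/4`, quarter modulus `K = 1`): ★ `β_W = 1/16`: `φ = 1/6`, rate `log 36 ≥ 3.58` (row-sum `1.27`); ★ `β_W = 1/8`: `φ = 2/7`, rate `log(49/4) ≥ 2.50` per lattice unit (row-sum rate
`log(16/9) ≈ 0.575`); ★ `β_W = 1/5`: `φ = 3/5`, rate `log(25/9) ≥ 1.02` (row-sum `log(10/9) ≈ 0.105`) (`su2_abs_cov_le_axis_oneEighth/_oneFifth`).
The uniqueness WINDOW (`ρ < 1`) is unchanged; only the RATE inside it is sharpened, and only for axis-separated supports (translates along an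
axis, plaquette two-point functions along an axis) — not the `setDistEdges` shape of `MassGapAt` for arbitrary supports.

References: H. Föllmer, LNM 1362 (1988) Ch. I (2.8), (2.13); Shen–Zhu–Zhu, CMP 400 (2023) §4 (one-link law, Dobrushin route).
-/

noncomputable section

open MeasureTheory ProbabilityTheory Filter Topology Function Finset
open scoped NNReal
open Literature.Probability.LatticeModels
open Literature.Probability.LatticeModels.DobrushinMetric
open Literature.MathematicalPhysics.QuantumLattice
open Literature.MathematicalPhysics.QuantumFieldTheory hiding ZdEdge
open Literature.MathematicalPhysics.QuantumFieldTheory.Balaban1983to89.StrongCouplingDobrushinWindow (OneLinkKRModulus)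
open Summit.Ventures.YMGap.RobustBall.DobrushinSupersolution Summit.Ventures.YMGap.RobustBall.ZdAxis

namespace Summit.Ventures.YMGap.RobustBall.ZdAxis

variable {d N : ℕ}

/-- The half-line profile `v(h) = φ^{max(a − h, 0)}` (integer exponent) is at most `1` and equals `1` on the half-line `h ≥ a`. [folklore] -/
theorem zpow_max_le_one {φ : ℝ} (hφ0 : 0 < φ) (hφ1 : φ ≤ 1) (m : ℤ) : φ ^ max m 0 ≤ 1 :=
  zpow_le_one_of_nonpos₀' hφ0 hφ1 (le_max_right _ _)
where
  /-- `φ^k ≤ 1` for `0 < φ ≤ 1`, `0 ≤ k`. [folklore] -/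
  zpow_le_one_of_nonpos₀' {φ : ℝ} (hφ0 : 0 < φ) (hφ1 : φ ≤ 1) {k : ℤ} (hk : 0 ≤ k) : φ ^ k ≤ 1 := by
    calc φ ^ k ≤ φ ^ (0 : ℤ) := zpow_le_zpow_right_of_le_one₀ hφ0 hφ1 hk
      _ = 1 := zpow_zero _

/-- The RATIO BOUND of the half-line profile on its slope: for `a − h ≥ 1` (the site strictly below the half-line) and every offset `D`,
`φ^{max(a − h − D, 0)} ≤ φ^{−D} · φ^{max(a − h, 0)}`. [folklore] -/
theorem zpow_max_sub_le {φ : ℝ} (hφ0 : 0 < φ) (hφ1 : φ ≤ 1) {m : ℤ} (hm : 1 ≤ m) (D : ℤ) :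
    φ ^ max (m - D) 0 ≤ φ ^ (-D) * φ ^ max m 0 := by
  rw [← zpow_add₀ hφ0.ne']
  refine zpow_le_zpow_right_of_le_one₀ hφ0 hφ1 ?_
  rw [max_eq_left (by omega : (0 : ℤ) ≤ m)]
  exact le_max_of_le_left (by omega)

/-- **EXPONENTIAL CLUSTERING OF `SU(N)` LATTICE YANG–MILLS ON `ℤ^d` ALONG AN AXIS, SINGLE-ENTRY RATE.**  `d ≥ 2`, `N ≥ 1`, 't Hooft
coupling `β` (bare `Nβ`), one-link modulus `OneLinkKRModulus N R K` on `R ≥ 2(d−1)|β|`, `κ = K|β|`; `0 < φ ≤ 1` with the PARALLEL condition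
`κ · 2(d−1)(φ⁻¹ + 1 + φ) ≤ 1`, the TRANSVERSE condition `κ(φ⁻¹² + 2φ⁻¹ + 2φ + φ² + 6(d−2)) ≤ 1` and the row condition `6(d−1)κ < 1`.  Then for EVERY
DLR state `μ`, all bounded measurable local `f, g` with Frobenius-Lipschitz vectors `δ_f, δ_g` on their supports `Δ_f, Δ_g`, every axis `i`,
threshold `a` and `n` with `H_i(y) ≥ a` on `Δ_g` and `H_i(x) + 2n ≤ a` on `Δ_f` (`H_i(x, μ) = 2x_i + [μ = i]`):
`|cov_μ(f, g)| ≤ 8N (Σ_{Δ_g} δ_g)(Σ_{Δ_f} δ_f) · φ^{2n}`. [cite: Follmer1988, Ch. I Theorem (2.13)] -/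
theorem ym_abs_cov_le_axis (hd : 2 ≤ d) (hN : 1 ≤ N) {β R K : ℝ} (hK : 0 ≤ K) (hR : |β| * (2 * ((d : ℝ) - 1)) ≤ R)
    (hmod : OneLinkKRModulus N R K) {φ : ℝ} (hφ0 : 0 < φ) (hφ1 : φ ≤ 1)
    (hpar : K * |β| * (2 * ((d - 1 : ℕ) : ℝ) * (φ⁻¹ + 1 + φ)) ≤ 1)
    (hperp : K * |β| * (φ⁻¹ ^ 2 + 2 * φ⁻¹ + 2 * φ + φ ^ 2 + 6 * ((d - 2 : ℕ) : ℝ)) ≤ 1)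
    (hρ : 6 * ((d : ℝ) - 1) * |β| * K < 1)
    {μ : Measure (LGConfig d (Matrix.specialUnitaryGroup (Fin N) ℂ))}
    (hμ : μ ∈ ymGibbsMeasures (d := d) (fundamentalRep (Fin N)) (N * β))
    {f g : LGConfig d (Matrix.specialUnitaryGroup (Fin N) ℂ) → ℝ} (hfm : Measurable f) {Δf : Finset (ZdEdge d)}
    (hfdep : DependsOn f (↑Δf : Set (ZdEdge d))) {Mf : ℝ} (hMf : ∀ σ, |f σ| ≤ Mf) {δf : ZdEdge d → ℝ}
    (hδf : IsLipBound suFrobDist f δf) (hgm : Measurable g) {Δg : Finset (ZdEdge d)}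
    (hgdep : DependsOn g (↑Δg : Set (ZdEdge d))) {Mg : ℝ} (hMg : ∀ σ, |g σ| ≤ Mg) {δg : ZdEdge d → ℝ}
    (hδg : IsLipBound suFrobDist g δg) (i : Fin d) (a : ℤ) (n : ℕ)
    (hga : ∀ y ∈ Δg, a ≤ 2 * y.1 i + (if y.2 = i then 1 else 0))
    (hfa : ∀ x ∈ Δf, 2 * x.1 i + (if x.2 = i then 1 else 0) + 2 * n ≤ a) :
    |cov[f, g; μ]| ≤ 8 * N * (∑ y ∈ Δg, δg y) * (∑ x ∈ Δf, δf x) * φ ^ (2 * n) := by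
  classical
  haveI : SecondCountableTopology (Matrix (Fin N) (Fin N) ℂ) :=
    inferInstanceAs (SecondCountableTopology (Fin N → Fin N → ℂ))
  haveI : SecondCountableTopology (Matrix.specialUnitaryGroup (Fin N) ℂ) :=
    Topology.IsEmbedding.subtypeVal.secondCountableTopology
  have hd1 : 1 ≤ d := by omega
  set κ : ℝ := K * |β| with hκ
  have hκ0 : 0 ≤ κ := by positivity
  set ρ : ℝ := 6 * ((d : ℝ) - 1) * |β| * K with hρdef
  have hd2 : (2 : ℝ) ≤ d := by exact_mod_cast hd
  have hρ0 : 0 ≤ ρ :=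
    mul_nonneg (mul_nonneg (mul_nonneg (by norm_num) (by linarith)) (abs_nonneg β)) hK
  -- the Wilson `ℤ^d` door (verbatim the tree's `dlrMassGap_of_oneLinkKRModulus` step)
  set C : ZdEdge d → ZdEdge d → ℝ := fun x y => K * |β| * linkInfluence x y with hCdef
  have hC0 : ∀ x y, 0 ≤ C x y := fun x y => by positivity
  have hrow : ∀ x, ∑ y ∈ linkPlaqNbr x, C x y ≤ ρ := by
    intro x
    simp only [hCdef]
    rw [← Finset.mul_sum]
    have hsum : ∑ y ∈ linkPlaqNbr x, (linkInfluence x y : ℝ) ≤ 6 * ((d : ℝ) - 1) := by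
      have h := sum_linkInfluence_le (d := d) x
      calc ∑ y ∈ linkPlaqNbr x, (linkInfluence x y : ℝ)
          = ((∑ y ∈ linkPlaqNbr x, linkInfluence x y : ℕ) : ℝ) := by push_cast; rfl
        _ ≤ ((6 * (d - 1) : ℕ) : ℝ) := by exact_mod_cast h
        _ = 6 * ((d : ℝ) - 1) := by push_cast [Nat.cast_sub hd1]; ring
    calc K * |β| * ∑ y ∈ linkPlaqNbr x, (linkInfluence x y : ℝ) ≤ K * |β| * (6 * ((d : ℝ) - 1)) :=
          mul_le_mul_of_nonneg_left hsum (by positivity)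
      _ = ρ := by rw [hρdef]; ring
  have hcontr : ∀ (x : ZdEdge d), ∀ y ∈ linkPlaqNbr x,
      ∀ (ω η : LGConfig d (Matrix.specialUnitaryGroup (Fin N) ℂ)),
      (∀ z, z ≠ y → ω z = η z) →
      ∀ (φ' : Matrix.specialUnitaryGroup (Fin N) ℂ → ℝ) (L : ℝ), Measurable φ' →
        (∃ M, ∀ s, |φ' s| ≤ M) → 0 ≤ L → (∀ a b, |φ' a - φ' b| ≤ L * suFrobDist a b) →
        |∫ s, φ' s ∂(siteLaw (ymSpecification (fundamentalRep (Fin N)) (N * β)) x ω) -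
            ∫ s, φ' s ∂(siteLaw (ymSpecification (fundamentalRep (Fin N)) (N * β)) x η)| ≤
          C x y * L * suFrobDist (ω y) (η y) := by
    intro x y _ ω η hωη φ' L hφm hφb hL hφL
    rw [siteLaw_ymSpecification_thooft β x ω, siteLaw_ymSpecification_thooft β x η]
    have hBω : matrixOpNorm (stapleField β x ω) ≤ R := (matrixOpNorm_stapleField_le hd1 hN β x ω).trans hR
    have hBη : matrixOpNorm (stapleField β x η) ≤ R := (matrixOpNorm_stapleField_le hd1 hN β x η).trans hR
    have key := hmod _ _ hBω hBη φ' L hφm hφb hL hφL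
    refine key.trans ?_
    have hdiff := frobNorm_stapleField_sub_le β x y hωη
    calc K * L * frobNorm (stapleField β x ω - stapleField β x η)
        ≤ K * L * (|β| * linkInfluence x y * suFrobDist (ω y) (η y)) :=
          mul_le_mul_of_nonneg_left hdiff (mul_nonneg hK hL)
      _ = C x y * L * suFrobDist (ω y) (η y) := by simp only [hCdef]; ring
  have hγ : IsSpecification (ymSpecification (d := d) (fundamentalRep (Fin N)) (N * β)) :=
    isSpecification_ymSpecification_of_t2Space _ (continuous_fundamentalRep (Fin N)) _
  have hKR : IsKRContraction (ymSpecification (d := d) (fundamentalRep (Fin N)) (N * β)) suFrobDist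
      linkPlaqNbr C :=
    isKRContraction_ymSpecification _ (continuous_fundamentalRep (Fin N)) _ hC0 hcontr
  have hμ' : IsGibbsMeasure (ymSpecification (d := d) (fundamentalRep (Fin N)) (N * β)) μ := hμ
  -- the half-line supersolution along the axis `i`
  set H : ZdEdge d → ℤ := fun z => 2 * z.1 i + (if z.2 = i then 1 else 0) with hH
  set v : ZdEdge d → ℝ := fun z => φ ^ max (a - H z) 0 with hv
  have hv0 : ∀ z, 0 ≤ v z := fun z => by simp only [hv]; exact zpow_nonneg hφ0.le _
  have hv1 : ∀ z, v z ≤ 1 := fun z => zpow_max_le_one hφ0 hφ1 _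
  have hvg : ∀ y ∈ Δg, 1 ≤ v y := fun y hy => by
    have : max (a - H y) 0 = 0 := max_eq_right (by have := hga y hy; simp only [hH]; omega)
    simp only [hv, this, zpow_zero, le_refl]
  -- supersolution inequality
  have hsuper : ∀ z ∉ Δg, ∑ w ∈ linkPlaqNbr z, C z w * v w ≤ v z := by
    intro z _
    by_cases hz : a - H z ≤ 0
    · -- on the half-line: `v z = 1`, row sum `≤ ρ ≤ 1`
      have hvz : v z = 1 := by simp only [hv, max_eq_right hz, zpow_zero]
      rw [hvz]
      calc ∑ w ∈ linkPlaqNbr z, C z w * v w ≤ ∑ w ∈ linkPlaqNbr z, C z w * 1 :=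
            Finset.sum_le_sum fun w _ => mul_le_mul_of_nonneg_left (hv1 w) (hC0 z w)
        _ ≤ ρ := by simpa using hrow z
        _ ≤ 1 := hρ.le
    · -- on the slope: the ratio bound and the offset multiset
      have hm : 1 ≤ a - H z := by omega
      set c : ℤ → ℝ := fun D => φ ^ (-D) with hc
      have hc0 : ∀ D, 0 ≤ c D := fun D => zpow_nonneg hφ0.le _
      have hratio : ∀ w : ZdEdge d, v w ≤ c (2 * (w.1 i - z.1 i) + (if w.2 = i then 1 else 0) - (if z.2 = i then 1 else 0)) * v z := by
        intro w
        have hD : a - H w = (a - H z) - (2 * (w.1 i - z.1 i) + (if w.2 = i then 1 else 0) - (if z.2 = i then 1 else 0)) := by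
          simp only [hH]; ring
        simp only [hv, hc]
        rw [hD]
        exact zpow_max_sub_le hφ0 hφ1 hm _
      have key := sum_linkInfluence_mul_le_axis hd c hc0 z i hv0 hratio (linkPlaqNbr z)
      have hc1 : c 1 = φ⁻¹ := by simp [hc]
      have hc0' : c 0 = 1 := by simp [hc]
      have hcm1 : c (-1) = φ := by simp [hc]
      have hc2 : c 2 = φ⁻¹ ^ 2 := by simp only [hc]; rw [zpow_neg, zpow_ofNat, inv_pow]
      have hcm2 : c (-2) = φ ^ 2 := by simp only [hc, neg_neg]; exact zpow_ofNat φ 2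
      rw [hc1, hc0', hcm1, hc2, hcm2] at key
      calc ∑ w ∈ linkPlaqNbr z, C z w * v w = K * |β| * ∑ w ∈ linkPlaqNbr z, (linkInfluence z w : ℝ) * v w := by
            rw [Finset.mul_sum]; exact Finset.sum_congr rfl fun w _ => by simp only [hCdef]; ring
        _ ≤ K * |β| * ((if z.2 = i then 2 * ((d - 1 : ℕ) : ℝ) * (φ⁻¹ + 1 + φ)
              else φ⁻¹ ^ 2 + 2 * φ⁻¹ + 2 * φ + φ ^ 2 + 6 * ((d - 2 : ℕ) : ℝ) * 1) * v z) :=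
            mul_le_mul_of_nonneg_left key (by positivity)
        _ ≤ 1 * v z := by
            rw [← mul_assoc]
            refine mul_le_mul_of_nonneg_right ?_ (hv0 z)
            split_ifs
            · exact hpar
            · rw [mul_one]; exact hperp
        _ = v z := one_mul _
  -- the covariance estimate with the supersolution, and `v ≤ φ^{2n}` on `Δ_f`
  have hcov := abs_covariance_le_of_supersolution_of_lt_one hγ hKR (r := suFrobDist) (R := 2 * Real.sqrt N)
    suFrobDist_nonneg suFrobDist_le (by positivity) hρ0 hρ hrow hμ' hfm hfdep hMf hδf hgm hgdep hMg hδg hv0 hvg hsuper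
  refine hcov.trans ?_
  have hvf : ∀ x ∈ Δf, min 1 (v x) ≤ φ ^ (2 * n) := by
    intro x hx
    refine (min_le_right _ _).trans ?_
    simp only [hv]
    rw [← zpow_natCast]
    refine zpow_le_zpow_right_of_le_one₀ hφ0 hφ1 ?_
    have := hfa x hx
    simp only [hH] at this ⊢
    push_cast
    refine le_max_of_le_left ?_
    omega
  have hsum : ∑ x ∈ Δf, min 1 (v x) * δf x ≤ ∑ x ∈ Δf, φ ^ (2 * n) * δf x :=
    Finset.sum_le_sum fun x hx => mul_le_mul_of_nonneg_right (hvf x hx) (hδf.nonneg x)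
  have hδg0 : 0 ≤ ∑ y ∈ Δg, δg y := Finset.sum_nonneg fun y _ => hδg.nonneg y
  have hN8 : (2 : ℝ) * (2 * Real.sqrt N) ^ 2 = 8 * N := by rw [mul_pow, Real.sq_sqrt (Nat.cast_nonneg N)]; ring
  calc 2 * (2 * Real.sqrt N) ^ 2 * (∑ y ∈ Δg, δg y) * ∑ x ∈ Δf, min 1 (v x) * δf x
      ≤ 2 * (2 * Real.sqrt N) ^ 2 * (∑ y ∈ Δg, δg y) * ∑ x ∈ Δf, φ ^ (2 * n) * δf x :=
        mul_le_mul_of_nonneg_left hsum (mul_nonneg (by positivity) hδg0)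
    _ = 8 * N * (∑ y ∈ Δg, δg y) * (∑ x ∈ Δf, δf x) * φ ^ (2 * n) := by rw [hN8, ← Finset.mul_sum]; ring

/-! ### `SU(2)`, `d = 4`: certified cells -/

/-- ★ **`SU(2)`, `d = 4`, `β_W = 1/8` (tree coupling `1/16`, 't Hooft `1/32`): axis rate `φ = 2/7`, i.e. decay `(4/49)^n = e^{−2.505 n}`
per lattice unit along an axis** — for EVERY DLR state and all axis-separated local observables (the tree's row-sum rate at this coupling
is `−log(9/16) ≈ 0.575`).  Conditions: `(1/32)·6·(7/2 + 1 + 2/7) = 0.897 ≤ 1`, `(1/32)(49/4 + 7 + 4/7 + 4/49 + 12) = 0.997 ≤ 1`. [folklore] -/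
theorem su2_abs_cov_le_axis_oneEighth {μ : Measure (LGConfig 4 (Matrix.specialUnitaryGroup (Fin 2) ℂ))}
    (hμ : μ ∈ ymGibbsMeasures (d := 4) (fundamentalRep (Fin 2)) (2 * (1 / 32)))
    {f g : LGConfig 4 (Matrix.specialUnitaryGroup (Fin 2) ℂ) → ℝ} (hfm : Measurable f) {Δf : Finset (ZdEdge 4)}
    (hfdep : DependsOn f (↑Δf : Set (ZdEdge 4))) {Mf : ℝ} (hMf : ∀ σ, |f σ| ≤ Mf) {δf : ZdEdge 4 → ℝ}
    (hδf : IsLipBound suFrobDist f δf) (hgm : Measurable g) {Δg : Finset (ZdEdge 4)}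
    (hgdep : DependsOn g (↑Δg : Set (ZdEdge 4))) {Mg : ℝ} (hMg : ∀ σ, |g σ| ≤ Mg) {δg : ZdEdge 4 → ℝ}
    (hδg : IsLipBound suFrobDist g δg) (i : Fin 4) (a : ℤ) (n : ℕ)
    (hga : ∀ y ∈ Δg, a ≤ 2 * y.1 i + (if y.2 = i then 1 else 0))
    (hfa : ∀ x ∈ Δf, 2 * x.1 i + (if x.2 = i then 1 else 0) + 2 * n ≤ a) :
    |cov[f, g; μ]| ≤ 8 * 2 * (∑ y ∈ Δg, δg y) * (∑ x ∈ Δf, δf x) * (2 / 7 : ℝ) ^ (2 * n) := by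
  have hmod := SlabAreaLawDimensions.su2_oneLinkKRModulus_of_le_one (R := 3 / 16) (by norm_num)
  have habs : |(1 / 32 : ℝ)| = 1 / 32 := abs_of_pos (by norm_num)
  have h := ym_abs_cov_le_axis (d := 4) (N := 2) (by norm_num) (by norm_num) (β := 1 / 32) zero_le_one
    (by rw [habs]; norm_num) hmod (φ := 2 / 7) (by norm_num) (by norm_num)
    (by rw [habs]; norm_num) (by rw [habs]; norm_num) (by rw [habs]; norm_num)
    hμ hfm hfdep hMf hδf hgm hgdep hMg hδg i a n hga hfa
  exact_mod_cast h

/-- ★ **`SU(2)`, `d = 4`, `β_W = 1/5` (tree coupling `1/10`, 't Hooft `1/20`): axis rate `φ = 3/5`, decay `(9/25)^n = e^{−1.02 n}` per lattice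
unit along an axis** for every DLR state (row-sum rate `−log(9/10) ≈ 0.105`).  Conditions: `(1/20)·6·(5/3 + 1 + 3/5) = 0.98`,
`(1/20)(25/9 + 10/3 + 6/5 + 9/25 + 12) = 0.983`. [folklore] -/
theorem su2_abs_cov_le_axis_oneFifth {μ : Measure (LGConfig 4 (Matrix.specialUnitaryGroup (Fin 2) ℂ))}
    (hμ : μ ∈ ymGibbsMeasures (d := 4) (fundamentalRep (Fin 2)) (2 * (1 / 20)))
    {f g : LGConfig 4 (Matrix.specialUnitaryGroup (Fin 2) ℂ) → ℝ} (hfm : Measurable f) {Δf : Finset (ZdEdge 4)}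
    (hfdep : DependsOn f (↑Δf : Set (ZdEdge 4))) {Mf : ℝ} (hMf : ∀ σ, |f σ| ≤ Mf) {δf : ZdEdge 4 → ℝ}
    (hδf : IsLipBound suFrobDist f δf) (hgm : Measurable g) {Δg : Finset (ZdEdge 4)}
    (hgdep : DependsOn g (↑Δg : Set (ZdEdge 4))) {Mg : ℝ} (hMg : ∀ σ, |g σ| ≤ Mg) {δg : ZdEdge 4 → ℝ}
    (hδg : IsLipBound suFrobDist g δg) (i : Fin 4) (a : ℤ) (n : ℕ)
    (hga : ∀ y ∈ Δg, a ≤ 2 * y.1 i + (if y.2 = i then 1 else 0))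
    (hfa : ∀ x ∈ Δf, 2 * x.1 i + (if x.2 = i then 1 else 0) + 2 * n ≤ a) :
    |cov[f, g; μ]| ≤ 8 * 2 * (∑ y ∈ Δg, δg y) * (∑ x ∈ Δf, δf x) * (3 / 5 : ℝ) ^ (2 * n) := by
  have hmod := SlabAreaLawDimensions.su2_oneLinkKRModulus_of_le_one (R := 3 / 10) (by norm_num)
  have habs : |(1 / 20 : ℝ)| = 1 / 20 := abs_of_pos (by norm_num)
  have h := ym_abs_cov_le_axis (d := 4) (N := 2) (by norm_num) (by norm_num) (β := 1 / 20) zero_le_one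
    (by rw [habs]; norm_num) hmod (φ := 3 / 5) (by norm_num) (by norm_num)
    (by rw [habs]; norm_num) (by rw [habs]; norm_num) (by rw [habs]; norm_num)
    hμ hfm hfdep hMf hδf hgm hgdep hMg hδg i a n hga hfa
  exact_mod_cast h


/-- ★ **`SU(2)`, `d = 4`, `β_W = 1/16` (tree coupling `1/32`, 't Hooft `1/64`): axis rate `φ = 1/6`, decay `(1/36)^n = e^{−3.58 n}` per lattice unit
along an axis** for every DLR state (row-sum rate `log(32/9) ≈ 1.27`).  Conditions: `(1/64)·6·(6 + 1 + 1/6) = 0.672`, `(1/64)(36 + 12 + 1/3 + 1/36 + 12) = 0.943`.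
[folklore] -/
theorem su2_abs_cov_le_axis_oneSixteenth {μ : Measure (LGConfig 4 (Matrix.specialUnitaryGroup (Fin 2) ℂ))}
    (hμ : μ ∈ ymGibbsMeasures (d := 4) (fundamentalRep (Fin 2)) (2 * (1 / 64)))
    {f g : LGConfig 4 (Matrix.specialUnitaryGroup (Fin 2) ℂ) → ℝ} (hfm : Measurable f) {Δf : Finset (ZdEdge 4)}
    (hfdep : DependsOn f (↑Δf : Set (ZdEdge 4))) {Mf : ℝ} (hMf : ∀ σ, |f σ| ≤ Mf) {δf : ZdEdge 4 → ℝ}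
    (hδf : IsLipBound suFrobDist f δf) (hgm : Measurable g) {Δg : Finset (ZdEdge 4)}
    (hgdep : DependsOn g (↑Δg : Set (ZdEdge 4))) {Mg : ℝ} (hMg : ∀ σ, |g σ| ≤ Mg) {δg : ZdEdge 4 → ℝ}
    (hδg : IsLipBound suFrobDist g δg) (i : Fin 4) (a : ℤ) (n : ℕ)
    (hga : ∀ y ∈ Δg, a ≤ 2 * y.1 i + (if y.2 = i then 1 else 0))
    (hfa : ∀ x ∈ Δf, 2 * x.1 i + (if x.2 = i then 1 else 0) + 2 * n ≤ a) :
    |cov[f, g; μ]| ≤ 8 * 2 * (∑ y ∈ Δg, δg y) * (∑ x ∈ Δf, δf x) * (1 / 6 : ℝ) ^ (2 * n) := by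
  have hmod := SlabAreaLawDimensions.su2_oneLinkKRModulus_of_le_one (R := 3 / 32) (by norm_num)
  have habs : |(1 / 64 : ℝ)| = 1 / 64 := abs_of_pos (by norm_num)
  have h := ym_abs_cov_le_axis (d := 4) (N := 2) (by norm_num) (by norm_num) (β := 1 / 64) zero_le_one
    (by rw [habs]; norm_num) hmod (φ := 1 / 6) (by norm_num) (by norm_num)
    (by rw [habs]; norm_num) (by rw [habs]; norm_num) (by rw [habs]; norm_num)
    hμ hfm hfdep hMf hδf hgm hgdep hMg hδg i a n hga hfa
  exact_mod_cast h


/-! ### The transversal plaquette–plaquette correlator -/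

/-- **THE PLAQUETTE TWO-POINT FUNCTION ALONG A TRANSVERSAL AXIS.**  Under the hypotheses of `ym_abs_cov_le_axis`, for a plaquette `p = (x, j < k)`
and an axis `i ∉ {j, k}`, the truncated correlation of `Re tr U_p` with its translate by `n·e_i` obeys
`|cov_μ(Re tr U_p, Re tr U_{p + n e_i})| ≤ 128 N² φ^{2n}` for EVERY DLR state (Lipschitz vectors `√N·𝟙_{edges}`, `StateLipschitzRows.isLipBound_plaquetteObs`).
[folklore] -/
theorem ym_abs_cov_plaquette_transversal (hd : 2 ≤ d) (hN : 1 ≤ N) {β R K : ℝ} (hK : 0 ≤ K) (hR : |β| * (2 * ((d : ℝ) - 1)) ≤ R)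
    (hmod : OneLinkKRModulus N R K) {φ : ℝ} (hφ0 : 0 < φ) (hφ1 : φ ≤ 1)
    (hpar : K * |β| * (2 * ((d - 1 : ℕ) : ℝ) * (φ⁻¹ + 1 + φ)) ≤ 1)
    (hperp : K * |β| * (φ⁻¹ ^ 2 + 2 * φ⁻¹ + 2 * φ + φ ^ 2 + 6 * ((d - 2 : ℕ) : ℝ)) ≤ 1)
    (hρ : 6 * ((d : ℝ) - 1) * |β| * K < 1)
    {μ : Measure (LGConfig d (Matrix.specialUnitaryGroup (Fin N) ℂ))}
    (hμ : μ ∈ ymGibbsMeasures (d := d) (fundamentalRep (Fin N)) (N * β))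
    (p : ZdPlaquette d) {i : Fin d} (hij : i ≠ p.2.1.1) (hik : i ≠ p.2.1.2) (n : ℕ) :
    |cov[plaquetteObs (fundamentalRep (Fin N)) p.1 p.2.1.1 p.2.1.2,
        plaquetteObs (fundamentalRep (Fin N)) (p.1 + Pi.single i (n : ℤ)) p.2.1.1 p.2.1.2; μ]| ≤
      128 * (N : ℝ) ^ 2 * φ ^ (2 * n) := by
  classical
  set q : ZdPlaquette d := (p.1 + Pi.single i (n : ℤ), p.2) with hq
  have hfL := StateLipschitzRows.isLipBound_plaquetteObs (N := N) p
  have hgL := StateLipschitzRows.isLipBound_plaquetteObs (N := N) q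
  have hfm := StateLipschitzRows.measurable_plaquetteObs_fundamental (N := N) p
  have hgm := StateLipschitzRows.measurable_plaquetteObs_fundamental (N := N) q
  have hfdep : DependsOn (plaquetteObs (fundamentalRep (Fin N)) p.1 p.2.1.1 p.2.1.2) (↑(plaquetteEdges p) : Set (ZdEdge d)) :=
    isCylinder_plaquetteObs (fundamentalRep (Fin N)) p
  have hgdep : DependsOn (plaquetteObs (fundamentalRep (Fin N)) q.1 q.2.1.1 q.2.1.2) (↑(plaquetteEdges q) : Set (ZdEdge d)) :=
    isCylinder_plaquetteObs (fundamentalRep (Fin N)) q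
  have hfb : ∀ U, |plaquetteObs (fundamentalRep (Fin N)) p.1 p.2.1.1 p.2.1.2 U| ≤ N := fun U =>
    abs_plaquetteObs_le_holds (fundamentalRep (Fin N)) fundamentalRep_mem_unitaryGroup p.1 _ _ U
  have hgb : ∀ U, |plaquetteObs (fundamentalRep (Fin N)) q.1 q.2.1.1 q.2.1.2 U| ≤ N := fun U =>
    abs_plaquetteObs_le_holds (fundamentalRep (Fin N)) fundamentalRep_mem_unitaryGroup q.1 _ _ U
  -- doubled `i`-coordinates: `2x_i` on `p`, `2x_i + 2n` on `q`
  have hHp : ∀ e ∈ plaquetteEdges p, (2 * e.1 i + (if e.2 = i then 1 else 0) : ℤ) = 2 * p.1 i := by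
    intro e he
    simp only [plaquetteEdges, Finset.mem_insert, Finset.mem_singleton] at he
    rcases he with rfl | rfl | rfl | rfl <;> simp [hij.symm, hik.symm]
  have hHq : ∀ e ∈ plaquetteEdges q, (2 * e.1 i + (if e.2 = i then 1 else 0) : ℤ) = 2 * p.1 i + 2 * n := by
    intro e he
    simp only [hq, plaquetteEdges, Finset.mem_insert, Finset.mem_singleton] at he
    rcases he with rfl | rfl | rfl | rfl <;> (simp [hij.symm, hik.symm]; ring)
  have key := ym_abs_cov_le_axis hd hN hK hR hmod hφ0 hφ1 hpar hperp hρ hμ hfm hfdep hfb hfL hgm hgdep hgb hgL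
    i (2 * p.1 i + 2 * n) n (fun e he => (hHq e he).symm.le) (fun e he => by rw [hHp e he])
  have hsq : Real.sqrt N * Real.sqrt N = N := Real.mul_self_sqrt (Nat.cast_nonneg N)
  have hsump : ∑ x ∈ plaquetteEdges p, (if x ∈ plaquetteEdges p then Real.sqrt N else 0) ≤ 4 * Real.sqrt N := by
    rw [Finset.sum_ite_of_true (fun x hx => hx), Finset.sum_const, nsmul_eq_mul]
    have := card_plaquetteEdges_le p
    exact mul_le_mul_of_nonneg_right (by exact_mod_cast this) (Real.sqrt_nonneg _)
  have hsumq : ∑ x ∈ plaquetteEdges q, (if x ∈ plaquetteEdges q then Real.sqrt N else 0) ≤ 4 * Real.sqrt N := by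
    rw [Finset.sum_ite_of_true (fun x hx => hx), Finset.sum_const, nsmul_eq_mul]
    have := card_plaquetteEdges_le q
    exact mul_le_mul_of_nonneg_right (by exact_mod_cast this) (Real.sqrt_nonneg _)
  have hsump0 : 0 ≤ ∑ x ∈ plaquetteEdges p, (if x ∈ plaquetteEdges p then Real.sqrt N else 0) :=
    Finset.sum_nonneg fun x hx => by rw [if_pos hx]; positivity
  have hφn : 0 ≤ φ ^ (2 * n) := pow_nonneg hφ0.le _
  calc _ ≤ 8 * N * (∑ y ∈ plaquetteEdges q, (if y ∈ plaquetteEdges q then Real.sqrt N else 0)) *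
        (∑ x ∈ plaquetteEdges p, (if x ∈ plaquetteEdges p then Real.sqrt N else 0)) * φ ^ (2 * n) := key
    _ ≤ 8 * N * (4 * Real.sqrt N) * (4 * Real.sqrt N) * φ ^ (2 * n) := by
        have hN0 : (0 : ℝ) ≤ 8 * N := by positivity
        have h1 := mul_le_mul hsumq hsump hsump0 (by positivity)
        nlinarith [mul_nonneg hN0 hφn]
    _ = 128 * (N : ℝ) * (Real.sqrt N * Real.sqrt N) * φ ^ (2 * n) := by ring
    _ = 128 * (N : ℝ) ^ 2 * φ ^ (2 * n) := by rw [hsq]; ring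

end Summit.Ventures.YMGap.RobustBall.ZdAxis

end
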